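import Literature.NumberTheory.Automorphic.ArchRankOneOrbitalFamilyParamOpen        -- ★ p851218 (this seat) (X3-rk1)(ii): `contDiffOn_cayley_orbitalIntegral_param_of_isOpen`, `fderiv_cayley_orbitalIntegral_param_prod_apply_of_isOpen`
import Literature.NumberTheory.Automorphic.ArchRankOneCasimirUniformIntervalCayley  -- ★ p851216 (this seat) (X3-rk1)(i): `exists_forall_norm_iteratedDeriv_cayley_orbitalIntegral_comp_clm_le_of_mem_Icc`
import HarnessLib

/-!
# (X3-rk1) THE TWO SOCKETS OF THE CORNER PEELING THEOREM, `U(J)`-Cayley rank-one instance: `hunif` (fixed-interval (ELL-∞-UNIF) at every `ℓ^∞(J, E)`) and `hread` (open-class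
# reader data), in the binder shapes of ★ `contDiffOn_and_forall_bound_nestedReader` (F0P3a-p02) VERBATIM (Varadarajan 1977 I §1.12; Bouaziz 1994 §3.1 (I₁)–(I₂))

Topic `NumberTheory/Automorphic`; namespace `Literature.NumberTheory.Automorphic.UnitaryGroup`.  THEOREMS ONLY (no `def`, no instance, no notation, no axiom, no named fact, no `sorry`);
kernel lane `--kind proof --supports stmt-HodgeConjecture-24833`.  Cell `pub/hodgecm-mathlib`, crux H413 (`stmt-HodgeConjecture-24833`), line LH3 (closer stub `stub_N9`), LETTER L1
clause (I₁) at the X′-CORNERS (organ O-L1e of leaf v5), brick **(X3-rk1)** (F0P3a-p02 (g21)'s split under LH3-plan (g4) RULING #18; author F0P3a-p04 (g24)): the two hypotheses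
`hunif`∕`hread` of the (X3-asm) peeling head `contDiffOn_and_forall_bound_nestedReader (Φ) (hT) (T₀) (hunif) (hread) (H) …` (F0P3a-p02, signature of record 2026-09-02T11:13:06Z),
discharged for `Φ := F` = the `U(J)`-Cayley normalised elliptic orbital integral (★ p851143 `hF` text, centre `z`), `T := {ψ | Real.sin ψ ≠ 0}`, `T₀ ⊆ Icc (−½) ½`, `M := M₂(ℂ)`.

* **`cayley_nestedReader_hunif`** — `∀ (J : Type) (Gf : M₂(ℂ) → ℓ^∞(J, E)), ContDiff ℝ ∞ Gf → HasCompactSupport Gf → ∀ n, ∃ B, ∀ ψ ∈ {sin ≠ 0} ∩ T₀, ∀ ℓ, ‖∂ⁿ F(ℓ ∘ Gf)(ψ)‖ ≤ ‖ℓ‖·B`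
  for ANY `T₀ ⊆ Icc (−½) ½` (★ p851216 head; `μ` Haar, right invariant; `E` complete so that `ℓ^∞(J, E)` is).
* **`cayley_nestedReader_hread`** — `∀ (P′ : Type) … (O : Set P′), IsOpen O → ∀ g, ContDiffOn ℝ ∞ (uncurry g) (O ×ˢ univ) → (∃ C, IsCompact C ∧ ∀ q ∈ O, ∀ X, X ∉ C → g q X = 0) →
  ContDiffOn ℝ ∞ (fun z => F (g z.1) z.2) (O ×ˢ {sin ≠ 0}) ∧ ∀ v z, z ∈ O ×ˢ {sin ≠ 0} → D[z ↦ F (g z.1) z.2](z)·(v, 0) = F (fun X => D[q ↦ g q X](z.1)·v) z.2` (★ p851218; `μ` finite on compacts).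
HONEST LABEL: HC_CM is proved only modulo the 7 printed citations (2 remaining named inputs: hLiu418 = `stmt-HodgeConjecture-24832`, h413 = `stmt-HodgeConjecture-24833`) until rung 0
closes; socket bookkeeping, count-neutral (letter-L1 (I₁)-corner brick; pays nothing by itself).

## References
* [Varadarajan1977] V. S. Varadarajan, *Harmonic Analysis on Real Reductive Groups*, LNM 576 (1977), Part I §1.12.
* [Bouaziz1994IntegralesOrbitales] A. Bouaziz, *Intégrales orbitales sur les groupes de Lie réductifs*, Ann. Sci. ÉNS 27 (1994), §3.1 (I₁)–(I₂) p. 579.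
* [HormanderALPDO1] L. Hörmander, *The Analysis of Linear Partial Differential Operators I*, 2nd ed. (1990), §1.1 Thm. 1.1.8–1.1.9; §2.1.
-/

set_option autoImplicit false

noncomputable section

namespace Literature.NumberTheory.Automorphic

namespace UnitaryGroup

open _root_.MeasureTheory _root_.MeasureTheory.Measure _root_.Set _root_.Filter _root_.Topology _root_.Complex
open _root_.Literature.Analysis.Calculus _root_.Literature.NumberTheory.Automorphic.RankOneCasimir
open scoped MatrixGroups ContDiff ComplexConjugate ENNReal
open scoped Matrix.Norms.Operator

variable {J : Matrix (Fin 2) (Fin 2) ℂ} (hJ : J = (StdForm.antidiagonal 2).over ℂ)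
  [MeasurableSpace ↥(unitaryGroupOfForm (starRingEnd ℂ) J)] [BorelSpace ↥(unitaryGroupOfForm (starRingEnd ℂ) J)]
  {E : Type} [NormedAddCommGroup E] [NormedSpace ℝ E] [CompleteSpace E]

include hJ in
/-- **THE `hunif` SOCKET of ★ `contDiffOn_and_forall_bound_nestedReader` for the `U(J)`-Cayley functional** (`T := {sin ≠ 0}`, any `T₀ ⊆ Icc (−½) ½`): for every index type `J′`, every
`Gf ∈ C_c^∞(M₂(ℂ), ℓ^∞(J′, E))` and every order `n` ONE `B` with `‖∂ⁿ F(ℓ ∘ Gf)(ψ)‖ ≤ ‖ℓ‖ · B` for all `ψ ∈ T ∩ T₀` and all CLMs `ℓ : ℓ^∞(J′, E) →L[ℝ] E` (★ p851216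
`exists_forall_norm_iteratedDeriv_cayley_orbitalIntegral_comp_clm_le_of_mem_Icc` at `E′ := ℓ^∞(J′, E)`; `sin ψ ≠ 0 ⇒ ψ ≠ 0`). [cite: Varadarajan1977, I §1.12]
[cite: Bouaziz1994IntegralesOrbitales, §3.1 (I₁)–(I₂) p. 579] -/
theorem cayley_nestedReader_hunif (μ : Measure ↥(unitaryGroupOfForm (starRingEnd ℂ) J)) [μ.IsHaarMeasure] [μ.IsMulRightInvariant] (z : Circle)
    (F : (Matrix (Fin 2) (Fin 2) ℂ → E) → ℝ → E)
    (hF : ∀ (f : Matrix (Fin 2) (Fin 2) ℂ → E) (ψ : ℝ), F f ψ = (2 * Real.sin ψ) •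
      ∫ h : ↥(unitaryGroupOfForm (starRingEnd ℂ) J),
        f (((h * ⟨Matrix.GeneralLinearGroup.mkOfDetNeZero !![(1 : ℂ), 1; 1, -1] det_cayleyTwo_ne_zero *
              circleDiagonal 2 ![z * Circle.exp ψ, z * Circle.exp (-ψ)] * (Matrix.GeneralLinearGroup.mkOfDetNeZero !![(1 : ℂ), 1; 1, -1] det_cayleyTwo_ne_zero)⁻¹,
            cayley_conj_circleDiagonal_mem_of_eq_over hJ _⟩ * h⁻¹ : ↥(unitaryGroupOfForm (starRingEnd ℂ) J)) : GL (Fin 2) ℂ) : Matrix (Fin 2) (Fin 2) ℂ) ∂μ)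
    {T₀ : Set ℝ} (hT₀ : T₀ ⊆ Icc (-(1 / 2 : ℝ)) (1 / 2)) :
    ∀ (J' : Type) (Gf : Matrix (Fin 2) (Fin 2) ℂ → lp (fun _ : J' => E) ⊤), ContDiff ℝ ∞ Gf → HasCompactSupport Gf → ∀ n : ℕ,
      ∃ B : ℝ, ∀ ψ ∈ {ψ : ℝ | Real.sin ψ ≠ 0} ∩ T₀, ∀ ℓ : lp (fun _ : J' => E) ⊤ →L[ℝ] E, ‖iteratedDeriv n (F (fun X => ℓ (Gf X))) ψ‖ ≤ ‖ℓ‖ * B := by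
  intro J' Gf hGf hGfc n
  obtain ⟨B, hB⟩ := exists_forall_norm_iteratedDeriv_cayley_orbitalIntegral_comp_clm_le_of_mem_Icc (E := E) (E' := lp (fun _ : J' => E) ⊤) hJ μ z F hF
    (fun (G' : Matrix (Fin 2) (Fin 2) ℂ → lp (fun _ : J' => E) ⊤) (ψ : ℝ) => (2 * Real.sin ψ) •
      ∫ h : ↥(unitaryGroupOfForm (starRingEnd ℂ) J),
        G' (((h * ⟨Matrix.GeneralLinearGroup.mkOfDetNeZero !![(1 : ℂ), 1; 1, -1] det_cayleyTwo_ne_zero *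
              circleDiagonal 2 ![z * Circle.exp ψ, z * Circle.exp (-ψ)] * (Matrix.GeneralLinearGroup.mkOfDetNeZero !![(1 : ℂ), 1; 1, -1] det_cayleyTwo_ne_zero)⁻¹,
            cayley_conj_circleDiagonal_mem_of_eq_over hJ _⟩ * h⁻¹ : ↥(unitaryGroupOfForm (starRingEnd ℂ) J)) : GL (Fin 2) ℂ) : Matrix (Fin 2) (Fin 2) ℂ) ∂μ)
    (fun _ _ => rfl) hGf hGfc n
  refine ⟨B, fun ψ hψ ℓ => hB ψ ⟨hT₀ hψ.2, fun h0 => hψ.1 ?_⟩ ℓ⟩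
  rw [Set.mem_singleton_iff.1 h0, Real.sin_zero]

include hJ in
/-- **THE `hread` SOCKET of ★ `contDiffOn_and_forall_bound_nestedReader` for the `U(J)`-Cayley functional** (`T := {sin ≠ 0}`; `μ` finite on compacts): for every finite-dimensional
parameter space `P′`, open `O ⊆ P′` and family `g` with `ContDiffOn ℝ ∞ (uncurry g) (O ×ˢ univ)` and one compact support on `O`, the reader `z ↦ F (g z.1) z.2` is `C^∞` on `O ×ˢ T` and
`D[z ↦ F (g z.1) z.2](z)·(v, 0) = F(∂_v g (z.1)) (z.2)` there (★ p851218). [cite: Varadarajan1977, I §1.12] [cite: HormanderALPDO1, Thm. 1.1.8–1.1.9] -/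
theorem cayley_nestedReader_hread (μ : Measure ↥(unitaryGroupOfForm (starRingEnd ℂ) J)) [IsFiniteMeasureOnCompacts μ] (z : Circle)
    (F : (Matrix (Fin 2) (Fin 2) ℂ → E) → ℝ → E)
    (hF : ∀ (f : Matrix (Fin 2) (Fin 2) ℂ → E) (ψ : ℝ), F f ψ = (2 * Real.sin ψ) •
      ∫ h : ↥(unitaryGroupOfForm (starRingEnd ℂ) J),
        f (((h * ⟨Matrix.GeneralLinearGroup.mkOfDetNeZero !![(1 : ℂ), 1; 1, -1] det_cayleyTwo_ne_zero *
              circleDiagonal 2 ![z * Circle.exp ψ, z * Circle.exp (-ψ)] * (Matrix.GeneralLinearGroup.mkOfDetNeZero !![(1 : ℂ), 1; 1, -1] det_cayleyTwo_ne_zero)⁻¹,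
            cayley_conj_circleDiagonal_mem_of_eq_over hJ _⟩ * h⁻¹ : ↥(unitaryGroupOfForm (starRingEnd ℂ) J)) : GL (Fin 2) ℂ) : Matrix (Fin 2) (Fin 2) ℂ) ∂μ) :
    ∀ (P' : Type) [NormedAddCommGroup P'] [NormedSpace ℝ P'] [FiniteDimensional ℝ P'] (O : Set P'), IsOpen O →
      ∀ g : P' → Matrix (Fin 2) (Fin 2) ℂ → E, ContDiffOn ℝ ∞ (Function.uncurry g) (O ×ˢ (univ : Set (Matrix (Fin 2) (Fin 2) ℂ))) →
        (∃ C : Set (Matrix (Fin 2) (Fin 2) ℂ), IsCompact C ∧ ∀ q ∈ O, ∀ X : Matrix (Fin 2) (Fin 2) ℂ, X ∉ C → g q X = 0) →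
          ContDiffOn ℝ ∞ (fun w : P' × ℝ => F (g w.1) w.2) (O ×ˢ {ψ : ℝ | Real.sin ψ ≠ 0}) ∧
          ∀ (v : P') (w : P' × ℝ), w ∈ O ×ˢ {ψ : ℝ | Real.sin ψ ≠ 0} →
            fderiv ℝ (fun w : P' × ℝ => F (g w.1) w.2) w (v, 0) = F (fun X => fderiv ℝ (fun q' : P' => g q' X) w.1 v) w.2 := by
  intro P' _ _ _ O hO g hg hgc
  exact ⟨contDiffOn_cayley_orbitalIntegral_param_of_isOpen hJ μ z F hF hO g hg hgc,
    fun v w hw => fderiv_cayley_orbitalIntegral_param_prod_apply_of_isOpen hJ μ z F hF hO g hg hgc v hw⟩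

end UnitaryGroup

end Literature.NumberTheory.Automorphic

end
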